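import Literature.ModelTheory.Quasiminimal.PregeometryStructures
import HarnessLib

/-!
# Quasiminimality from a back-and-forth system of local isomorphisms

Trunk `Literature/ModelTheory`, topic quasiminimality. Companion of
`PregeometryStructures.lean` (Bays–Hart–Hyttinen–Kesälä–Kirby 2014: weakly quasiminimal
pregeometry structures are quasiminimal), written for the proof of quasiminimality of Zilber's
pseudo-exponential fields (`Literature.NumberTheory.Transcendental.IsZilberField.isQuasiminimal`,
`Literature/NumberTheory/Transcendental/ZilberFieldQuasiminimal.lean`).

In Zilber's method (Zilber 2005 §5; Kirby, *On quasiminimal excellent classes*, J. Symbolic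
Logic 75 (2010), Thm 2.1 and Lemma 5.1; Bays–Hart–Hyttinen–Kesälä–Kirby 2014 §§2–3) the
quasiminimality of a structure `M` is obtained from a *back-and-forth system of partial
isomorphisms* of `M` (in the application: isomorphisms between exponential-algebraic closures of
finite sets) all of whose members over a finite set `b` identify any two points outside a
countable "closure" of `b`. The abstract content is Karp's lemma: members of a back-and-forth
system preserve all first-order formulas, so a set definable over `b` contains all or no points
outside the closure of `b`.

This file isolates that abstract step in a form that makes *no reference to a pregeometry and no
choice of an expanded language*: the system is an arbitrary family of relations
`E n : (Fin n → M) → (Fin n → M) → Prop` ("the finite tuples `x` and `y` correspond under some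
member of the system") which is symmetric, stable under passing to sub-tuples, preserves the
*unnested* atomic facts `xᵢ = xⱼ`, `xᵢ = f(x_{ι 1}, …, x_{ι k})`, `R(x_{ι 1}, …, x_{ι k})`, and has
the forth property. Preservation of arbitrary atomic formulas (whose terms may leave the domain of
a partial isomorphism, e.g. `exp (x²)` for an isomorphism of `ℚ`-linear hulls) is then *derived*
by unnesting terms along forth-steps (`IsLocalIsoSystem.eq_realize_of_snoc`), and Karp's lemma
(`FirstOrder.Language.realize_iff_of_isBackAndForth` of `PregeometryStructures.lean`) gives
preservation of all first-order formulas (`IsLocalIsoSystem.realize_iff`). The quasiminimality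
criterion `IsLocalIsoSystem.countable_or_countable_compl` is Kirby 2010, Lemma 5.1 (second part),
with the automorphisms of its proof replaced by the back-and-forth system (as in
Bays–Hart–Hyttinen–Kesälä–Kirby 2014, Prop. 7.1, where this replacement is what makes excellence
unnecessary for quasiminimality).

## Contents

* `FirstOrder.Language.IsLocalIsoSystem L E` — the axioms of a back-and-forth system of local
  isomorphisms, on finite tuples.
* `IsLocalIsoSystem.forth_append`, `….eq_realize_of_snoc`, `….snoc_realize` — forth for
  finite tuples; corresponding extensions send term values to term values.
* `IsLocalIsoSystem.realize_atomic_iff`, `….realize_iff`, `….formula_realize_iff` — Karp's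
  lemma for such systems (all **proved**).
* `IsLocalIsoSystem.countable_or_countable_compl` — quasiminimality criterion (**proved**).

## Design

* Deliberate dot-notation extension in Mathlib's namespace `FirstOrder.Language` (precedents:
  `FirstOrder.Language.IsQuasiminimal`, `FirstOrder.Language.IsBackAndForth`), so that one writes
  `L.IsLocalIsoSystem E`.
* Tuples are `Fin n → M`, extended by `Fin.snoc`/`Fin.append`, matching
  `FirstOrder.Language.BoundedFormula.Realize` and `PregeometryStructures.lean`.
* No countability of `L`, no pregeometry and no uncountability of `M` is assumed: the criterion
  asks, for each finite tuple `b`, for *some* countable set outside of which points are pairwise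
  `E`-conjugate over `b`.
* Mathlib has `FirstOrder.Language.PartialEquiv` (partial isomorphisms between substructures)
  and `IsExtensionPair`, but their domains are substructures, which is exactly what fails in the
  application (hulls are not closed under `exp`); hence the unnested formulation here.

## References

* J. Kirby, *On quasiminimal excellent classes*, J. Symbolic Logic 75 (2010) 551–564,
  arXiv:0707.4496: Thm 2.1 (back-and-forth over closed sets), Lemma 5.1 (quasiminimality).
* M. Bays, B. Hart, T. Hyttinen, M. Kesälä, J. Kirby, *Quasiminimal structures and excellence*,
  Bull. LMS 46 (2014) 155–163, arXiv:1210.2008: §2 (first paragraph), §3, Prop. 7.1.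
* B. Zilber, *Pseudo-exponentiation on algebraically closed fields of characteristic zero*,
  Ann. Pure Appl. Logic 132 (2005) 67–95, §5.
-/

noncomputable section

open Set FirstOrder FirstOrder.Language

universe u v w

namespace FirstOrder.Language

variable (L : Language.{u, v}) {M : Type w} [L.Structure M]

/-- A **back-and-forth system of local isomorphisms** of an `L`-structure `M`, presented through
the relations `E n x y` = "the `n`-tuples `x` and `y` correspond under some member of the system"
(Kirby 2010, proof of Thm 2.1: partial embeddings `h_n` with finite preimage, extended back and
forth; Bays–Hart–Hyttinen–Kesälä–Kirby 2014 §3). The axioms: symmetry, stability under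
sub-tuples and re-indexing, preservation of the unnested atomic facts (equalities between
coordinates, values of basic functions among the coordinates, basic relations), and the forth
property. A deliberate dot-notation extension in Mathlib's namespace `FirstOrder.Language`.
[cite: Kirby2010QMEC, Thm 2.1 (proof)] [cite: BHHKK2014, §3] -/
structure IsLocalIsoSystem (E : (n : ℕ) → (Fin n → M) → (Fin n → M) → Prop) : Prop where
  /-- Symmetry (inverse of a partial isomorphism). -/
  symm : ∀ {n : ℕ} {x y : Fin n → M}, E n x y → E n y x
  /-- Sub-tuples and re-indexings of corresponding tuples correspond (restriction). -/
  comp : ∀ {n : ℕ} {x y : Fin n → M}, E n x y → ∀ {m : ℕ} (g : Fin m → Fin n),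
    E m (x ∘ g) (y ∘ g)
  /-- Corresponding tuples have the same equalities between coordinates. -/
  apply_eq : ∀ {n : ℕ} {x y : Fin n → M}, E n x y → ∀ {i j : Fin n}, x i = x j → y i = y j
  /-- Corresponding tuples have the same values of basic functions among their coordinates. -/
  funMap_eq : ∀ {n : ℕ} {x y : Fin n → M}, E n x y → ∀ {k : ℕ} (f : L.Functions k)
    (ι : Fin k → Fin n) (i : Fin n),
    x i = Structure.funMap f (x ∘ ι) → y i = Structure.funMap f (y ∘ ι)
  /-- Corresponding tuples satisfy the same basic relations among their coordinates. -/
  relMap : ∀ {n : ℕ} {x y : Fin n → M}, E n x y → ∀ {k : ℕ} (R : L.Relations k)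
    (ι : Fin k → Fin n), Structure.RelMap R (x ∘ ι) → Structure.RelMap R (y ∘ ι)
  /-- Forth: every one-point extension on the left is matched on the right. -/
  forth : ∀ {n : ℕ} {x y : Fin n → M}, E n x y → ∀ a : M, ∃ b : M,
    E (n + 1) (Fin.snoc x a) (Fin.snoc y b)

namespace IsLocalIsoSystem

variable {L} {E : (n : ℕ) → (Fin n → M) → (Fin n → M) → Prop}

/-- Back: from symmetry and forth. [folklore] -/
theorem back (h : L.IsLocalIsoSystem E) {n : ℕ} {x y : Fin n → M} (hxy : E n x y) (b : M) :
    ∃ a : M, E (n + 1) (Fin.snoc x a) (Fin.snoc y b) := by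
  obtain ⟨a, ha⟩ := h.forth (h.symm hxy) b
  exact ⟨a, h.symm ha⟩

/-- Forth for a finite tuple: iterate the forth property. [folklore] -/
theorem forth_append (h : L.IsLocalIsoSystem E) {n : ℕ} {x y : Fin n → M} (hxy : E n x y) :
    ∀ (k : ℕ) (u : Fin k → M), ∃ c : Fin k → M, E (n + k) (Fin.append x u) (Fin.append y c)
  | 0, u => ⟨Fin.elim0, by
      obtain rfl : u = Fin.elim0 := funext fun i => i.elim0
      rw [Fin.append_elim0, Fin.append_elim0]
      exact h.comp hxy _⟩
  | k + 1, u => by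
      obtain ⟨c₀, hc₀⟩ := forth_append h hxy k (Fin.init u)
      obtain ⟨b, hb⟩ := h.forth hc₀ (u (Fin.last k))
      refine ⟨Fin.snoc c₀ b, ?_⟩
      conv_lhs => rw [← Fin.snoc_init_self u]
      rw [Fin.append_snoc, Fin.append_snoc]
      exact hb

/-- The index map presenting `Fin.snoc x (x j)` as a re-indexing of `x`. [folklore] -/
theorem snoc_apply_eq_comp {n : ℕ} (x : Fin n → M) (j : Fin n) :
    (Fin.snoc x (x j) : Fin (n + 1) → M) = x ∘ (Fin.snoc (fun i : Fin n => i) j : Fin (n + 1) → Fin n) := by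
  funext i
  refine Fin.lastCases ?_ (fun i => ?_) i
  · simp
  · simp

/-- The index map presenting `(x, uᵢ)` as a sub-tuple of `(x, u)`. [folklore] -/
theorem append_comp_pick {n k : ℕ} (x : Fin n → M) (u : Fin k → M) (i : Fin k) :
    Fin.append x u ∘ (Fin.snoc (fun j : Fin n => Fin.castAdd k j) (Fin.natAdd n i) :
      Fin (n + 1) → Fin (n + k)) = (Fin.snoc x (u i) : Fin (n + 1) → M) := by
  funext j
  refine Fin.lastCases ?_ (fun j => ?_) j
  · simp
  · simp

/-- **Corresponding extensions send term values to term values.** If `(x, t(x)) ~ (y, c)` for a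
term `t` in the coordinates of `x` (through `ρ`), then `c = t(y)`: by induction on `t`, unnesting
one function symbol at a time with the forth property and reading off the value with
`funMap_eq`. This is why members of the system preserve atomic formulas although their "domains"
need not be substructures. [folklore] -/
theorem eq_realize_of_snoc (h : L.IsLocalIsoSystem E) {n : ℕ} {x y : Fin n → M} {β : Type*}
    (ρ : β → Fin n) (t : L.Term β) :
    ∀ {c : M}, E (n + 1) (Fin.snoc x (t.realize (x ∘ ρ))) (Fin.snoc y c) →
      c = t.realize (y ∘ ρ) := by
  induction t with
  | var b =>
    intro c hc
    have h1 : (Fin.snoc x ((var b : L.Term β).realize (x ∘ ρ)) : Fin (n + 1) → M) (Fin.last n) =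
        (Fin.snoc x ((var b : L.Term β).realize (x ∘ ρ)) : Fin (n + 1) → M) (ρ b).castSucc := by
      simp
    simpa using h.apply_eq hc h1
  | func f ts ih =>
    intro c hc
    -- unnest: add the values of the arguments on both sides
    set w : Fin _ → M := fun i => (ts i).realize (x ∘ ρ) with hw
    obtain ⟨c', H⟩ := h.forth_append hc _ w
    have hc' : ∀ i, c' i = (ts i).realize (y ∘ ρ) := by
      intro i
      have Hi := h.comp H (Fin.snoc (fun j : Fin (n + 1) => Fin.castAdd _ j) (Fin.natAdd (n + 1) i))
      rw [append_comp_pick, append_comp_pick] at Hi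
      have Hi' := h.comp Hi (Fin.snoc (fun j : Fin n => j.castSucc.castSucc) (Fin.last (n + 1)) :
        Fin (n + 1) → Fin (n + 2))
      have e1 : (Fin.snoc (Fin.snoc x ((func f ts).realize (x ∘ ρ))) (w i) : Fin (n + 2) → M) ∘
          (Fin.snoc (fun j : Fin n => j.castSucc.castSucc) (Fin.last (n + 1)) :
            Fin (n + 1) → Fin (n + 2)) = (Fin.snoc x ((ts i).realize (x ∘ ρ)) : Fin (n + 1) → M) := by
        funext j
        refine Fin.lastCases ?_ (fun j => ?_) j
        · simp [hw]
        · simp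
      have e2 : (Fin.snoc (Fin.snoc y c) (c' i) : Fin (n + 2) → M) ∘
          (Fin.snoc (fun j : Fin n => j.castSucc.castSucc) (Fin.last (n + 1)) :
            Fin (n + 1) → Fin (n + 2)) = (Fin.snoc y (c' i) : Fin (n + 1) → M) := by
        funext j
        refine Fin.lastCases ?_ (fun j => ?_) j
        · simp
        · simp
      rw [e1, e2] at Hi'
      exact ih i Hi'
    -- read off the value of `f` at the arguments
    have e0 : (Fin.append (Fin.snoc x ((func f ts).realize (x ∘ ρ))) w : Fin (n + 1 + _) → M) ∘
        (fun i => Fin.natAdd (n + 1) i) = w := by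
      funext i; simp
    have key := h.funMap_eq H f (fun i => Fin.natAdd (n + 1) i) (Fin.castAdd _ (Fin.last n)) (by
      rw [e0]; simp [hw])
    have e3 : (Fin.append (Fin.snoc y c) c' : Fin (n + 1 + _) → M) (Fin.castAdd _ (Fin.last n)) = c := by
      simp
    have e4 : (Fin.append (Fin.snoc y c) c' : Fin (n + 1 + _) → M) ∘ (fun i => Fin.natAdd (n + 1) i) =
        fun i => (ts i).realize (y ∘ ρ) := by
      funext i
      simp [hc' i]
    rw [e3, e4] at key
    simpa using key

/-- Corresponding tuples extend by the values of any term: `(x, t(x)) ~ (y, t(y))`. [folklore] -/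
theorem snoc_realize (h : L.IsLocalIsoSystem E) {n : ℕ} {x y : Fin n → M} (hxy : E n x y)
    {β : Type*} (ρ : β → Fin n) (t : L.Term β) :
    E (n + 1) (Fin.snoc x (t.realize (x ∘ ρ))) (Fin.snoc y (t.realize (y ∘ ρ))) := by
  obtain ⟨c, hc⟩ := h.forth hxy (t.realize (x ∘ ρ))
  have := h.eq_realize_of_snoc ρ t hc
  subst this
  exact hc

/-- The valuation `Sum.elim v xs` of a bounded formula is the concatenated tuple `Fin.append v xs`
read through `finSumFinEquiv`. [folklore] -/
theorem sumElim_eq_append_comp {k l : ℕ} (v : Fin k → M) (xs : Fin l → M) :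
    Sum.elim v xs = Fin.append v xs ∘ Sum.elim (Fin.castAdd l) (Fin.natAdd k) := by
  funext i
  rcases i with i | i <;> simp

/-- One direction of the preservation of atomic bounded formulas. [folklore] -/
theorem realize_atomic_imp (h : L.IsLocalIsoSystem E) {k l : ℕ} {v v' : Fin k → M}
    {xs ys : Fin l → M} (hE : E (k + l) (Fin.append v xs) (Fin.append v' ys))
    {φ : L.BoundedFormula (Fin k) l} (hφ : φ.IsAtomic) :
    φ.Realize v xs → φ.Realize v' ys := by
  cases hφ with
  | equal t₁ t₂ =>
    simp only [BoundedFormula.realize_bdEqual]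
    rw [sumElim_eq_append_comp v xs, sumElim_eq_append_comp v' ys]
    intro heq
    have h1 := h.snoc_realize hE (Sum.elim (Fin.castAdd l) (Fin.natAdd k)) t₁
    rw [heq] at h1
    exact h.eq_realize_of_snoc _ t₂ h1
  | rel R ts =>
    simp only [BoundedFormula.realize_rel]
    rw [sumElim_eq_append_comp v xs, sumElim_eq_append_comp v' ys]
    intro hR
    set ρ : Fin k ⊕ Fin l → Fin (k + l) := Sum.elim (Fin.castAdd l) (Fin.natAdd k) with hρ
    set w : Fin _ → M := fun i => (ts i).realize (Fin.append v xs ∘ ρ) with hw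
    obtain ⟨c, H⟩ := h.forth_append hE _ w
    have hc : ∀ i, c i = (ts i).realize (Fin.append v' ys ∘ ρ) := by
      intro i
      have Hi := h.comp H (Fin.snoc (fun j : Fin (k + l) => Fin.castAdd _ j) (Fin.natAdd (k + l) i))
      rw [append_comp_pick, append_comp_pick] at Hi
      exact h.eq_realize_of_snoc ρ (ts i) Hi
    have key := h.relMap H R (fun i => Fin.natAdd (k + l) i) (by
      have : (Fin.append (Fin.append v xs) w : Fin (k + l + _) → M) ∘ (fun i => Fin.natAdd (k + l) i) = w := by
        funext i; simp
      rw [this]; exact hR)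
    have e : (Fin.append (Fin.append v' ys) c : Fin (k + l + _) → M) ∘ (fun i => Fin.natAdd (k + l) i) =
        fun i => (ts i).realize (Fin.append v' ys ∘ ρ) := by
      funext i; simp [hc i]
    rwa [e] at key

/-- Members of a back-and-forth system of local isomorphisms preserve atomic bounded formulas
(the hypothesis `atomic` of `FirstOrder.Language.IsBackAndForth`). [folklore] -/
theorem realize_atomic_iff (h : L.IsLocalIsoSystem E) {k l : ℕ} {v v' : Fin k → M}
    {xs ys : Fin l → M} (hE : E (k + l) (Fin.append v xs) (Fin.append v' ys))
    {φ : L.BoundedFormula (Fin k) l} (hφ : φ.IsAtomic) :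
    φ.Realize v xs ↔ φ.Realize v' ys :=
  ⟨h.realize_atomic_imp hE hφ, h.realize_atomic_imp (h.symm hE) hφ⟩

/-- **Karp's lemma for back-and-forth systems of local isomorphisms**: corresponding tuples
satisfy the same first-order formulas (Kirby 2010 §5, proof of Lemma 5.4: "by induction on
formulas"; Bays–Hart–Hyttinen–Kesälä–Kirby 2014 §2, first paragraph).
[cite: Kirby2010QMEC, Lemma 5.4 (proof)] [cite: BHHKK2014, §2] -/
theorem realize_iff (h : L.IsLocalIsoSystem E) {k l : ℕ} {v v' : Fin k → M} {xs ys : Fin l → M}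
    (hE : E (k + l) (Fin.append v xs) (Fin.append v' ys)) (φ : L.BoundedFormula (Fin k) l) :
    φ.Realize v xs ↔ φ.Realize v' ys := by
  have hS : L.IsBackAndForth v v'
      (fun l (xs ys : Fin l → M) => E (k + l) (Fin.append v xs) (Fin.append v' ys)) := by
    refine ⟨fun hxy φ hφ => h.realize_atomic_iff hxy hφ, fun {l xs ys} hxy a => ?_,
      fun {l xs ys} hxy b => ?_⟩
    · obtain ⟨b, hb⟩ := h.forth hxy a
      refine ⟨b, ?_⟩
      rwa [Fin.append_snoc, Fin.append_snoc]
    · obtain ⟨a, ha⟩ := h.back hxy b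
      refine ⟨a, ?_⟩
      rwa [Fin.append_snoc, Fin.append_snoc]
  exact realize_iff_of_isBackAndForth hS φ hE

/-- Karp's lemma, formula version: `E`-corresponding tuples satisfy the same first-order formulas.
[cite: Kirby2010QMEC, Lemma 5.4 (proof)] -/
theorem formula_realize_iff (h : L.IsLocalIsoSystem E) {k : ℕ} {v v' : Fin k → M}
    (hE : E k v v') (φ : L.Formula (Fin k)) : φ.Realize v ↔ φ.Realize v' := by
  have : E (k + 0) (Fin.append v Fin.elim0) (Fin.append v' Fin.elim0) := by
    rw [Fin.append_elim0, Fin.append_elim0]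
    exact h.comp hE _
  exact h.realize_iff this φ

/-- **Quasiminimality criterion** (Kirby 2010, Lemma 5.1, second part, with the automorphisms of
its proof replaced by a back-and-forth system as in Bays–Hart–Hyttinen–Kesälä–Kirby 2014,
Prop. 7.1; Zilber 2005 §5). Suppose `M` carries a back-and-forth system of local isomorphisms
such that for every finite tuple `b` there is a countable set `H ⊆ M` outside of which any two
points are conjugate over `b` (`(b, a) ~ (b, c)`). Then every subset of `M` definable with
parameters is countable or co-countable: a definable `S = φ(M, b)` has finitely many parameters
`b`; by Karp's lemma all points outside `H` agree on `φ(x, b)`, so `S ⊆ H` or `M ∖ H ⊆ S`.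
[cite: Kirby2010QMEC, Lemma 5.1] [cite: BHHKK2014, Prop. 7.1] -/
theorem countable_or_countable_compl (h : L.IsLocalIsoSystem E)
    (hgen : ∀ {k : ℕ} (b : Fin k → M), ∃ H : Set M, H.Countable ∧
      ∀ ⦃a c : M⦄, a ∉ H → c ∉ H → E (k + 1) (Fin.snoc b a) (Fin.snoc b c))
    {S : Set M} (hS : (Set.univ : Set M).Definable₁ L S) : S.Countable ∨ Sᶜ.Countable := by
  classical
  -- finitely many parameters and a defining formula
  obtain ⟨A₀, -, hA₀⟩ := Set.definable_iff_finitely_definable.1 hS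
  obtain ⟨φ, hφ⟩ := Set.definable_iff_exists_formula_sum.1 hA₀
  -- enumerate the parameters
  set k := Fintype.card (A₀ : Set M) with hk
  let eA : (A₀ : Set M) ≃ Fin k := Fintype.equivFin _
  let b : Fin k → M := fun i => (eA.symm i : M)
  obtain ⟨H, hHcount, hH⟩ := hgen b
  -- membership in `S` in terms of `φ`
  have hmem : ∀ a : M, a ∈ S ↔ φ.Realize (Sum.elim ((↑) : ↥(A₀ : Set M) → M) ![a]) := by
    intro a
    have := Set.ext_iff.1 hφ ![a]
    simpa only [Set.mem_setOf_eq, Matrix.cons_val_fin_one] using this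
  -- reindex `φ` to a formula in the variables `Fin (k + 1)` = (parameters, point)
  let g : (A₀ : Set M) ⊕ Fin 1 → Fin (k + 1) := Sum.elim (Fin.castSucc ∘ eA) fun _ => Fin.last k
  have hg : ∀ a : M, (Fin.snoc b a : Fin (k + 1) → M) ∘ g =
      Sum.elim ((↑) : ↥(A₀ : Set M) → M) ![a] := by
    intro a
    funext x
    rcases x with x | x
    · simp [g, b]
    · simp [g]
  have hmem' : ∀ a : M, a ∈ S ↔ (φ.relabel g).Realize (Fin.snoc b a : Fin (k + 1) → M) := by
    intro a
    rw [hmem, Formula.realize_relabel, hg]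
  -- all points outside `H` behave alike
  have hgen' : ∀ ⦃a c : M⦄, a ∉ H → c ∉ H → (a ∈ S ↔ c ∈ S) := by
    intro a c ha hc
    rw [hmem' a, hmem' c]
    exact h.formula_realize_iff (hH ha hc) _
  by_cases hex : ∃ a ∈ S, a ∉ H
  · obtain ⟨a, haS, haH⟩ := hex
    refine Or.inr (hHcount.mono fun c hc => ?_)
    by_contra hcH
    exact hc ((hgen' haH hcH).1 haS)
  · refine Or.inl (hHcount.mono fun a ha => ?_)
    by_contra haH
    exact hex ⟨a, ha, haH⟩

end IsLocalIsoSystem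

end FirstOrder.Language
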